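import Summits.QuantumFields.YangMills.Theorems.BalabanUVNodesK0AllTorusOfStepTokensGuarded
import Summits.QuantumFields.YangMills.Theorems.BalabanUVNodesN07Thm1ScaledInterfaceInstance

/-!
# K0⁷ V20-G stub 1 — LOCATED-STUB1-GRID-NUMERICS, kernel side: (§0; (2.5) at `r = 0` = dag-n07-e's `N07Thm1ScaledInterfaceInstance.RkOfRecord_zero_r`, the interface-instance numerics `M = 1`, `r = 0` BY NAME) under the REGISTERED guard `c ≤ ν.M₁ ∧ k + c₀ ≤ F.m + K` the (8)-step prefix admits records with UNIT
# (and with torus-exceeding) `𝐃_j`-blocks, so the record's grid numerics `hgran` ∕ `hdiv` displayed by the road-R0′ suppliers are NOT consequences of the prefix; (§1) two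
# further guard conjuncts `F.L ^ c₁ ∣ M` ∧ `∀ i ≤ k, L^i·M·R_i ∣ sitesPerDir 0` supply them; (§2) that four-conjunct CANDIDATE guard is MET by the K0 body at `θ₁₅ᶜᶜᴹᵂ(j; γ)`
# for `c ≤ L^j`, `c₀ ≤ j + 1`, `c₁ ≤ j` — the all-torus row P11 and the ⁵∕⁷ closers under it (p635083 §1 BY NAME)

Cell `pub-ymgap`, width seat `pub-ymgap-k0-s1-w3` generation 8 (K0⁷ `stmt-QuantumFields-20541`, V20-G stub 1 `stub_prop8StepCoPG13` helper lane;
`--kind proof --supports stmt-QuantumFields-20541 --as helper`).  NEW leaf, theorems only (0 `def`, 0 `sorry`); nothing in the tree is modified.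
[15] = [Balaban1985Variational]; [6] = [Balaban1985RegularSpaces]; [III] = [Balaban1988Convergent]; [I] = [Balaban1987RG1]; [4] = [Balaban1984PropagatorsII].

WHY (LOCATED-STUB1-GRID-NUMERICS, cell bus 2026-08-28 15:11Z, for the lane owner dag-n07-e ∕ the plan ∕ a referee to confirm — NOT a ruling, NOT a registration).
The registered V20-G stub-1 text (`K0V20GDefs.Prop8StepCoPGAt F`, skeleton dead8a8df885c226) guards [15] Prop. 8's top step (`Node00.Prop8RegSepTopStepG F 2 suppDom Adm B₃ a₀ a₁`,
`Node00/CriticalOnFibreTopGuarded` :108) by the CONCRETE two-letter guard `Adm := fun ν _M _g K k _s => c ≤ ν.M₁ ∧ k + c₀ ≤ F.m + K`; the sentence's prefix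
`∀ (ν : Stage7Numerics) (M : ℕ) (g : ℕ → ℝ) (K k : ℕ) (s : SeqOfRecord F ν M g K k), Sect2.SeqSeparated ν.M₁ s → 0 < ν.M₁ → Adm ν M g K k s → 1 ≤ k → …` leaves the
record's basic-cube letter `M` and its coupling history `g` (hence `R_j = RkOfRecord L ν.r (g j)`, [III] (2.5)) FREE, and the guard ignores them.  The record-side suppliers of
road R0′ through which the S6 head's `HCHART` (dag-n07-w4 FILE 7 `…N07SplitClauseHeadKnitRanged` :238–239, same prefix) is to be discharged DISPLAY the record's GRID NUMERICS
`hdiv : ∀ j, 1 ≤ j → j ≤ k → dCubeSide (F.P K).L M (RkOfRecord (F.P K).L ν.r (g j)) j ∣ (F.P K).sitesPerDir 0` (torus-compatible `𝐃_j`-partitions) and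
`hgran : ∀ j, 1 ≤ j → j ≤ k → M₁ ∣ M * RkOfRecord (F.P K).L ν.r (g j)` (the [4] (2.1) block structure of `Ω_j(s)` at the `H`-expansion granularity `M₁ := L·M_h ≥ L·M_h⁰`):
dag-n07-w6 `…N07RecordDomainsAdm22` (p618589) `adm22_domainsOfSeq_seqOfRecord` ∕ `adm22_meet_domainsOfSeq_seqOfRecord` :329–346 (the OUTWARD-MEET family `D″` that the lane
owner's ROAD WORD g22 marks REQUIRED), `inOm_domainsOfSeq_seqOfRecord_iff` :357, k0-s1-w1 `…K0Stub1FlatAveragingDictionaryLevelsAtRecord` (p621779) :52.  §0 shows — in the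
kernel — that under the registered guard there are prefix letters `(ν, M, g)` with `M·R_j = 1` at every `j` (so `hgran` FAILS at every granularity `≥ 2`, in particular at every
`L·M_h`, `F.L > 11`) and prefix letters with `L^j·M·R_j > sitesPerDir 0` (so `hdiv` FAILS): the two rows are not merely unproved but UNDERIVABLE from the V20-G prefix.  Print
never meets such records: [III] (2.1) p. 254, (2.5) p. 255, p. 257 take `M`, `R_j` powers of `L` with «partitions compatible with all other partitions», and [6] (1.3) p. 77
(«Ω_j is a sum of cubes of size M₁Lʲη») is the block-structure HALF of print's admissibility — the tree's `Sect2.SeqSeparated` encodes only the separation half (1.6) (its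
docstring, `Node00/Record12BgRowAnalysis` :455–462, records exactly this range difference).  Same CLASS as the two located defects the V20 text already repaired
(LOCATED-STUB1-FLOOR: `c ≤ ν.M₁`; LOCATED-UNGUARDED-LEVELS: `k + c₀ ≤ F.m + K`), on the two prefix letters the guard still ignores.
§1–§2 show that the MINIMAL REPAIR CANDIDATE — two more conjuncts `F.L ^ c₁ ∣ M ∧ (∀ i, 1 ≤ i → i ≤ k → dCubeSide (F.P K).L M (RkOfRecord (F.P K).L ν.r (g i)) i ∣
(F.P K).sitesPerDir 0)` with `c₁` OUTERMOST next to `c c₀` — (§1) supplies p618589's `hgran` at every granularity `L·M_h ∣ F.L^{c₁}` (the stub's prover picks `c₁ := a′ + 1`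
for its `M_h = L^{a′}`) and `hdiv` verbatim, and (§2) is MET BY THE K0 BODY at the witness `θ₁₅ᶜᶜᴹᵂ(j; γ)` with ZERO new analysis: the fourth conjunct at the body's
instantiation `(ν, M, g, K, k) := (θ.ν, θ.τ9.M, gOfRecord₁₃ θ p, p.K, n)` IS `PartCompat₁₃ F N θ p n` (`Node00/Record13` :1238–1239), which the body's `hAdm` binder (this
lineage's p635083 §1 :116–117) already receives; the third is `theta13OfThm1CCMW_τ9_M : τ9.M = F.L ^ j` with `c₁ ≤ j` — so p635083 §1's all-torus lift runs unchanged and the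
row P11 + the ⁵∕⁷ closers follow under the candidate guard exactly as p635083 §2–§3 do under V20-G (proofs = theirs with two more `hAdm` goals).  The plan words any V21
(director-ym №219 (2): a located defect of a registered stub text → referee → plan); NOTHING here registers, replaces or votes on a text.

WHAT IS PROVED (sorry-free; 0 `def`; axioms standard).  §0 ★ `exists_v20G_guarded_prefix_unit_blocks` · ★
`exists_v20G_guarded_prefix_wrapping_blocks` · `not_dvd_of_mul_eq_one`; §1 `hgran_of_pow_dvd`; §2 ★★ `bgSepCoPAt_theta13OfThm1CCMW_gridGuard_of_thm1RegSepCoP7MG_of_thm1GaugeG_of_hcomp_allTorus`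
· `exists_k0SepCoP_thm1CCMW_gridGuard_…` · `exists_k0SepCoPH_thm1CCMW_gridGuard_…` · ★★ `exists_k0SepCoPH_thm1CCMW_gridGuard_of_thm1RegSepCoP7MG_of_gauge9TopStepG_of_hcomp_allTorus`.
HONEST FRAMING: count-neutral located arithmetic + kernel re-keying BY NAME; every [15]∕[6]∕[I] sentence is a HYPOTHESIS (a `Prop`, never asserted, inhabited nowhere here); the
compositions are CONDITIONAL; the candidate guard is NOT a registered text; `stub_prop8StepCoPG13` ∕ K0⁷ ∕ K1⁹ NOT closed; N07 NOT discharged; counts unmoved (typed 28∕28 ·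
discharged 5∕27); the route closes only the conditional finite-𝕋⁴ rung `BalabanLadder.UV` — the YM mass gap (Clay) is NOT proved by any of this; nothing continuum ∕ ℝ⁴ ∕ OS.
No `sorry`, `def`, `instance`, `notation`.
-/

noncomputable section

open MeasureTheory
open scoped Matrix.Norms.L2Operator

namespace Summit.QuantumFields.YangMills.Theorems.K0Stub1GridNumericsGuardWitness

open Literature.MathematicalPhysics.QuantumFieldTheory.Balaban1983to89
open Literature.MathematicalPhysics.QuantumFieldTheory.Balaban1983to89.Node00
open Literature.MathematicalPhysics.QuantumFieldTheory.Balaban1983to89.T4Continuum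
open Literature.MathematicalPhysics.QuantumFieldTheory.Balaban1983to89.FlowStep
open Literature.MathematicalPhysics.QuantumFieldTheory.Balaban1983to89.FlowStepRuns
open Literature.MathematicalPhysics.QuantumFieldTheory.Balaban1983to89.B14.Eq218Concrete
open Literature.MathematicalPhysics.QuantumFieldTheory.Balaban1983to89.B15DeterminingSets
open Literature.MathematicalPhysics.QuantumFieldTheory.Balaban1983to89.B12RegularSpaces111
open Literature.MathematicalPhysics.QuantumFieldTheory.Balaban1983to89.B14RegularSpaces234
open Summit.QuantumFields.YangMills.BalabanUVNodes.N07Thm1Top7FromProp8 (variationalThm1RegSepCoP7MG_of_prop8TopStepG)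
open Summit.QuantumFields.YangMills.Theorems.K0AllTorusOfStepTokensGuarded (succ_add_le_of_partCompat₁₃ bgAtDatumCoP_of_thm1RegSepCoP7MG_of_thm1GaugeG_allTorus)
open Summit.QuantumFields.YangMills.BalabanUVNodes.N07Thm1ScaledInterfaceInstance (RkOfRecord_zero_r)

/-! ## §0  The registered V20-G guard admits records with UNIT and with TORUS-EXCEEDING `𝐃_j`-blocks: `hgran` ∕ `hdiv` are underivable from the prefix -/

section Witness

/-- `M·R = 1` is divisible by nothing `≥ 2`. [folklore] -/
theorem not_dvd_of_mul_eq_one {t M R : ℕ} (h1 : M * R = 1) (ht : 2 ≤ t) : ¬ t ∣ M * R := fun h => by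
  rw [h1] at h
  have := Nat.le_of_dvd Nat.one_pos h
  omega

/-- ★ **THE REGISTERED V20-G GUARD ADMITS RECORDS WITH UNIT `𝐃_j`-BLOCKS.**  For every family `F`, every pair of guard letters `(c, c₀)` and every `(K, k)` inside the level
guard, there are prefix letters `ν` (with `c ≤ ν.M₁`, `0 < ν.M₁`, exponent `ν.r = 0`), `M := 1` and a coupling history `g` at which the guard `c ≤ ν.M₁ ∧ k + c₀ ≤ F.m + K`
HOLDS while `M · R_j = 1` and `dCubeSide L M R_j j = L^j` at EVERY level `j`: there `Ω_j(s)` ranges over ALL unions of unit `j`-cubes, and p618589's `hgran : M₁ ∣ M·R_j`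
FAILS at every granularity `M₁ ≥ 2` — in particular at every `H`-expansion granularity `L·M_h`, `M_h ≥ 1` (`F.L > 11`).  So `hgran` is NOT a consequence of the V20-G prefix.
(Print never meets such records: [III] takes `M`, `R_j` powers of `L`, `M` «sufficiently large»; [6] (1.3) makes `Ω_j` a union of `M₁`-cubes.)
[cite: Balaban1988Convergent, (2.1) p.254, (2.5) p.255, p.257; Balaban1985RegularSpaces, (1.3)–(1.6) p.77; Balaban1985Variational, Prop. 8 p.304] -/
theorem exists_v20G_guarded_prefix_unit_blocks (F : T4Family) (c c₀ K k : ℕ) (hk : k + c₀ ≤ F.m + K) :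
    ∃ (ν : Stage7Numerics) (M : ℕ) (g : ℕ → ℝ), (c ≤ ν.M₁ ∧ k + c₀ ≤ F.m + K) ∧ 0 < ν.M₁ ∧ ν.r = 0 ∧ M = 1 ∧
      (∀ j, M * RkOfRecord F.L ν.r (g j) = 1 ∧ dCubeSide F.L M (RkOfRecord F.L ν.r (g j)) j = F.L ^ j) ∧
      ∀ (Mh : ℕ), 1 ≤ Mh → ∀ j, ¬ F.L * Mh ∣ M * RkOfRecord F.L ν.r (g j) := by
  refine ⟨⟨max c 1, 1, 0, 0, 0, 0, 0, 0⟩, 1, fun _ => 0, ⟨le_max_left _ _, hk⟩, lt_max_of_lt_right Nat.one_pos, rfl, rfl, fun j => ?_, fun Mh hMh j => ?_⟩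
  · simp [RkOfRecord_zero_r, dCubeSide]
  · refine not_dvd_of_mul_eq_one (by simp [RkOfRecord_zero_r]) ?_
    have := F.hL11
    nlinarith

/-- ★ **THE REGISTERED V20-G GUARD ADMITS RECORDS WHOSE `𝐃_j`-BLOCKS EXCEED THE TORUS.**  Same letters with `M := L^{m+K+1}` (and `R_j = 1`): the guard holds, yet at EVERY level
`j` the block side `L^j·M·R_j = L^{j+m+K+1}` does NOT divide the period `2·L^{m+K}` — p618589's `hdiv` (the `PartCompat`-shaped torus compatibility of the `𝐃_j`-partitions,
[III] p. 257) FAILS; so `hdiv` is NOT a consequence of the V20-G prefix either.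
[cite: Balaban1988Convergent, (2.1) p.254, (2.17)–(2.18) p.257; Balaban1987RG1, (0.1) p.251] -/
theorem exists_v20G_guarded_prefix_wrapping_blocks (F : T4Family) (c c₀ K k : ℕ) (hk : k + c₀ ≤ F.m + K) :
    ∃ (ν : Stage7Numerics) (M : ℕ) (g : ℕ → ℝ), (c ≤ ν.M₁ ∧ k + c₀ ≤ F.m + K) ∧ 0 < ν.M₁ ∧ M = F.L ^ (F.m + K + 1) ∧
      ∀ j, ¬ dCubeSide (F.P K).L M (RkOfRecord (F.P K).L ν.r (g j)) j ∣ (F.P K).sitesPerDir 0 := by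
  refine ⟨⟨max c 1, 1, 0, 0, 0, 0, 0, 0⟩, F.L ^ (F.m + K + 1), fun _ => 0, ⟨le_max_left _ _, hk⟩, lt_max_of_lt_right Nat.one_pos, rfl, fun j h => ?_⟩
  rw [F.sitesPerDir_eq K, T4Family.P_L] at h
  simp only [dCubeSide, RkOfRecord_zero_r, mul_one] at h
  have hL3 : 3 ≤ F.L := by have := F.hL11; omega
  have hpos : 0 < 2 * F.L ^ (F.m + K) := by positivity
  have hle := Nat.le_of_dvd hpos h
  have hlt : 2 * F.L ^ (F.m + K) < F.L ^ j * F.L ^ (F.m + K + 1) := by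
    calc 2 * F.L ^ (F.m + K) < F.L * F.L ^ (F.m + K) := by
          have : 0 < F.L ^ (F.m + K) := by positivity
          nlinarith
      _ = F.L ^ (F.m + K + 1) := by ring
      _ ≤ F.L ^ j * F.L ^ (F.m + K + 1) := Nat.le_mul_of_pos_left _ (by positivity)
  omega

end Witness

/-! ## §1  The two CANDIDATE guard conjuncts supply p618589's grid numerics -/

section Supply

/-- **`hgran` FROM THE CANDIDATE CONJUNCT `L^{c₁} ∣ M`**, at every granularity `L·M_h ∣ L^{c₁}` (the stub's prover picks `c₁ := a′ + 1` for its `M_h = L^{a′}`) and every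
coupling history: `L·M_h ∣ M ∣ M·R_j`.  (`hdiv` is the second candidate conjunct VERBATIM.) [cite: Balaban1988Convergent, (2.1) p.254, (2.5) p.255 (bookkeeping); Balaban1984PropagatorsII, (2.1) p.224] -/
theorem hgran_of_pow_dvd {L c₁ M Mh : ℕ} (hM : L ^ c₁ ∣ M) (hMh : L * Mh ∣ L ^ c₁) (r : ℕ) (g : ℕ → ℝ) (k : ℕ) :
    ∀ j, 1 ≤ j → j ≤ k → L * Mh ∣ M * RkOfRecord L r (g j) :=
  fun _ _ _ => (hMh.trans hM).mul_right _

/-- `L·L^{a′} ∣ L^{c₁}` once `a′ + 1 ≤ c₁` (the stub prover's choice of `c₁`). [folklore] -/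
theorem mul_pow_dvd_pow_of_succ_le {L a' c₁ : ℕ} (h : a' + 1 ≤ c₁) : L * L ^ a' ∣ L ^ c₁ := by
  rw [← pow_succ']
  exact pow_dvd_pow L (by omega)

end Supply

/-! ## §2  ★★ The four-conjunct CANDIDATE guard is MET by the K0 body at `θ₁₅ᶜᶜᴹᵂ(j; γ)` (`c ≤ L^j`, `c₀ ≤ j + 1`, `c₁ ≤ j`): row P11 and the ⁵∕⁷ closers under it -/

section AtWitnessGridGuard

variable {F : T4Family} {N : ℕ} [NeZero N] {j c c₀ c₁ : ℕ} {γ ε₀ ε₂₉ B₃ B₃' a₀ a₁ : ℝ}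

/-- **★★ THE (7)-GUARDED SEPARATED ROW P11 AT THE Co CARRIER AT `θ₁₅ᶜᶜᴹᵂ(j; γ)` UNDER THE FOUR-CONJUNCT CANDIDATE GUARD**
`Adm := fun ν M g K k _ => c ≤ ν.M₁ ∧ k + c₀ ≤ F.m + K ∧ F.L ^ c₁ ∣ M ∧ ∀ i, 1 ≤ i → i ≤ k → dCubeSide (F.P K).L M (RkOfRecord (F.P K).L ν.r (g i)) i ∣ (F.P K).sitesPerDir 0`
with `c ≤ L^j`, `c₀ ≤ j + 1`, `c₁ ≤ j` — p635083 §2 VERBATIM but for the guard: p635083 §1's all-torus lift (guard-generic, outer `hAdm`) with `hAdm` DISCHARGED at every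
torus-compatible run of the window by: the floor (`ν.M₁ = L^j ≥ c`), the level letter (p635083 §0: `n + j + 1 ≤ F.m + p.K`), the cube letter `τ9.M = L^j` (`L^{c₁} ∣ L^j`),
and `PartCompat₁₃ F N θ p n` ITSELF (the fourth conjunct at `(θ.ν, θ.τ9.M, gOfRecord₁₃ θ p, p.K, n)`, by `rfl`).  CONDITIONAL on the two [15] sentences; nothing asserted.
[cite: Balaban1985Variational, (6)–(7) p.278, Thm 1 (8)–(9) p.279, (144)–(152) pp.300–301, Prop. 8 p.304, p.304 lines 1–2; Balaban1985RegularSpaces, (1.3)–(1.9) p.77; Balaban1988Convergent, Thm 1 p.262, (2.1) p.254, (2.4)–(2.8) pp.255–256, (2.12)–(2.13) pp.256–257, (2.17)–(2.18) p.257, (2.25)–(2.28) pp.258–259; Balaban1987RG1, Thm 1 p.259, (0.1) p.251, (1.12) p.262] -/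
theorem bgSepCoPAt_theta13OfThm1CCMW_gridGuard_of_thm1RegSepCoP7MG_of_thm1GaugeG_of_hcomp_allTorus (hγ0 : 0 < γ) (hγ : γ ≤ 1 / 2) (hε : 0 < ε₀) (hε' : 0 < ε₂₉) (hB : 0 ≤ B₃) (hB' : 0 ≤ B₃')
    (ha₀ : 0 < a₀) (ha₁ : 0 < a₁) (hc : c ≤ F.L ^ j) (hc₀ : c₀ ≤ j + 1) (hc₁ : c₁ ≤ j)
    (h15 : VariationalThm1RegSepCoP7MG F N (fun ν M g K k _s => c ≤ ν.M₁ ∧ k + c₀ ≤ F.m + K ∧ F.L ^ c₁ ∣ M ∧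
      ∀ i, 1 ≤ i → i ≤ k → dCubeSide (F.P K).L M (RkOfRecord (F.P K).L ν.r (g i)) i ∣ (F.P K).sitesPerDir 0) B₃ a₀ a₁)
    (h15G : VariationalThm1GaugeRegSepCoP7MG F N (F.L ^ j) (fun ν M g K k _s => c ≤ ν.M₁ ∧ k + c₀ ≤ F.m + K ∧ F.L ^ c₁ ∣ M ∧
      ∀ i, 1 ≤ i → i ≤ k → dCubeSide (F.P K).L M (RkOfRecord (F.P K).L ν.r (g i)) i ∣ (F.P K).sitesPerDir 0) B₃ B₃' a₀ a₁)
    (hcomp : ∀ (p : B12.RunParams) (n : ℕ), n ≤ p.K → Step.InInterval (theta13OfThm1CCMW F N j γ ε₀ ε₂₉ B₃ B₃' a₀ a₁).γ n (gOfRecord₁₃ F N (theta13OfThm1CCMW F N j γ ε₀ ε₂₉ B₃ B₃' a₀ a₁) p) → ∀ m, m < n →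
      (theta13OfThm1CCMW F N j γ ε₀ ε₂₉ B₃ B₃' a₀ a₁).s2.cR * epsOfRecord (theta13OfThm1CCMW F N j γ ε₀ ε₂₉ B₃ B₃' a₀ a₁).ν (gOfRecord₁₃ F N (theta13OfThm1CCMW F N j γ ε₀ ε₂₉ B₃ B₃' a₀ a₁) p) m ≤ 2 * ((theta13OfThm1CCMW F N j γ ε₀ ε₂₉ B₃ B₃' a₀ a₁).s2.cR * epsOfRecord (theta13OfThm1CCMW F N j γ ε₀ ε₂₉ B₃ B₃' a₀ a₁).ν (gOfRecord₁₃ F N (theta13OfThm1CCMW F N j γ ε₀ ε₂₉ B₃ B₃' a₀ a₁) p) (m + 1)))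
    (hcompRev : ∀ (p : B12.RunParams) (n : ℕ), n ≤ p.K → Step.InInterval (theta13OfThm1CCMW F N j γ ε₀ ε₂₉ B₃ B₃' a₀ a₁).γ n (gOfRecord₁₃ F N (theta13OfThm1CCMW F N j γ ε₀ ε₂₉ B₃ B₃' a₀ a₁) p) → ∀ m, m < n →
      (theta13OfThm1CCMW F N j γ ε₀ ε₂₉ B₃ B₃' a₀ a₁).s2.cR * epsOfRecord (theta13OfThm1CCMW F N j γ ε₀ ε₂₉ B₃ B₃' a₀ a₁).ν (gOfRecord₁₃ F N (theta13OfThm1CCMW F N j γ ε₀ ε₂₉ B₃ B₃' a₀ a₁) p) (m + 1) ≤ 2 * ((theta13OfThm1CCMW F N j γ ε₀ ε₂₉ B₃ B₃' a₀ a₁).s2.cR * epsOfRecord (theta13OfThm1CCMW F N j γ ε₀ ε₂₉ B₃ B₃' a₀ a₁).ν (gOfRecord₁₃ F N (theta13OfThm1CCMW F N j γ ε₀ ε₂₉ B₃ B₃' a₀ a₁) p) m)) :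
    ∀ (p : B12.RunParams) (n : ℕ), n ≤ p.K → Step.InInterval (theta13OfThm1CCMW F N j γ ε₀ ε₂₉ B₃ B₃' a₀ a₁).γ n (gOfRecord₁₃ F N (theta13OfThm1CCMW F N j γ ε₀ ε₂₉ B₃ B₃' a₀ a₁) p) → PartCompat₁₃ F N (theta13OfThm1CCMW F N j γ ε₀ ε₂₉ B₃ B₃' a₀ a₁) p n →
      ∀ s : SeqOfRecord F (theta13OfThm1CCMW F N j γ ε₀ ε₂₉ B₃ B₃' a₀ a₁).ν (theta13OfThm1CCMW F N j γ ε₀ ε₂₉ B₃ B₃' a₀ a₁).τ9.M (gOfRecord₁₃ F N (theta13OfThm1CCMW F N j γ ε₀ ε₂₉ B₃ B₃' a₀ a₁) p) p.K n, Sect2.SeqSeparated (theta13OfThm1CCMW F N j γ ε₀ ε₂₉ B₃ B₃' a₀ a₁).ν.M₁ s →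
      ∀ W : MSField (F.P p.K) (SU N), W ∈ suppOfRecord₁₃P F N (theta13OfThm1CCMW F N j γ ε₀ ε₂₉ B₃ B₃' a₀ a₁) p n s →
      Sect2.DataSmall7PTop (avOfRecord F N p.K) s.Ω (suppDomOfRecord F (theta13OfThm1CCMW F N j γ ε₀ ε₂₉ B₃ B₃' a₀ a₁).ν p.K s.Ω) n (fun j' => (theta13OfThm1CCMW F N j γ ε₀ ε₂₉ B₃ B₃' a₀ a₁).s2.cR * epsOfRecord (theta13OfThm1CCMW F N j γ ε₀ ε₂₉ B₃ B₃' a₀ a₁).ν (gOfRecord₁₃ F N (theta13OfThm1CCMW F N j γ ε₀ ε₂₉ B₃ B₃' a₀ a₁) p) j') W →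
      ∀ j', 1 ≤ j' → j' ≤ n → ∀ X : (Sect2.domSys (F.P p.K) (theta13OfThm1CCMW F N j γ ε₀ ε₂₉ B₃ B₃' a₀ a₁).τ9.M j').Dom,
      (Sect2.domSites (F.P p.K) (theta13OfThm1CCMW F N j γ ε₀ ε₂₉ B₃ B₃' a₀ a₁).τ9.M j' X ⊆ s.Λ j' →
        Sect2.ofBackgroundC (settingOfRecord₁₃ F N (theta13OfThm1CCMW F N j γ ε₀ ε₂₉ B₃ B₃' a₀ a₁) p).ι (UbgOfRecord₁₃CoP F N (theta13OfThm1CCMW F N j γ ε₀ ε₂₉ B₃ B₃' a₀ a₁) p n s W) ∈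
          Sect2.spaceI (settingOfRecord₁₃ F N (theta13OfThm1CCMW F N j γ ε₀ ε₂₉ B₃ B₃' a₀ a₁) p) ((theta13OfThm1CCMW F N j γ ε₀ ε₂₉ B₃ B₃' a₀ a₁).Rz p.K) (theta13OfThm1CCMW F N j γ ε₀ ε₂₉ B₃ B₃' a₀ a₁).τ9.M j' (Sect2.domSites (F.P p.K) (theta13OfThm1CCMW F N j γ ε₀ ε₂₉ B₃ B₃' a₀ a₁).τ9.M j' X)
            ((settingOfRecord₁₃ F N (theta13OfThm1CCMW F N j γ ε₀ ε₂₉ B₃ B₃' a₀ a₁) p).lf.alpha0 ((settingOfRecord₁₃ F N (theta13OfThm1CCMW F N j γ ε₀ ε₂₉ B₃ B₃' a₀ a₁) p).flow.g j')) ((settingOfRecord₁₃ F N (theta13OfThm1CCMW F N j γ ε₀ ε₂₉ B₃ B₃' a₀ a₁) p).lf.alpha1 ((settingOfRecord₁₃ F N (theta13OfThm1CCMW F N j γ ε₀ ε₂₉ B₃ B₃' a₀ a₁) p).flow.g j'))) ∧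
      (Sect2.admB (F.P p.K) (theta13OfThm1CCMW F N j γ ε₀ ε₂₉ B₃ B₃' a₀ a₁).ν (theta13OfThm1CCMW F N j γ ε₀ ε₂₉ B₃ B₃' a₀ a₁).τ9.M (gOfRecord₁₃ F N (theta13OfThm1CCMW F N j γ ε₀ ε₂₉ B₃ B₃' a₀ a₁) p) s.Ω s.Λ j' (Sect2.domSites (F.P p.K) (theta13OfThm1CCMW F N j γ ε₀ ε₂₉ B₃ B₃' a₀ a₁).τ9.M j' X) = true →
        Sect2.ofBackgroundC (settingOfRecord₁₃ F N (theta13OfThm1CCMW F N j γ ε₀ ε₂₉ B₃ B₃' a₀ a₁) p).ι (UbgOfRecord₁₃CoP F N (theta13OfThm1CCMW F N j γ ε₀ ε₂₉ B₃ B₃' a₀ a₁) p n s W) ∈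
          Sect2.spaceMS (settingOfRecord₁₃ F N (theta13OfThm1CCMW F N j γ ε₀ ε₂₉ B₃ B₃' a₀ a₁) p) ((theta13OfThm1CCMW F N j γ ε₀ ε₂₉ B₃ B₃' a₀ a₁).Rz p.K) (theta13OfThm1CCMW F N j γ ε₀ ε₂₉ B₃ B₃' a₀ a₁).τ9.M j' (Sect2.domSites (F.P p.K) (theta13OfThm1CCMW F N j γ ε₀ ε₂₉ B₃ B₃' a₀ a₁).τ9.M j' X) s.Ω) := by
  intro p n hn hw hpc s hsep W _ h7
  cases n with
  | zero => intro j' h1 hj'; exfalso; omega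
  | succ n =>
    rw [UbgOfRecord₁₃CoP_succ]
    refine bgAtDatumCoP_of_thm1RegSepCoP7MG_of_thm1GaugeG_allTorus (theta13OfThm1CCMW F N j γ ε₀ ε₂₉ B₃ B₃' a₀ a₁)
      (admissible_theta13OfThm1CCMW_of_le_half F N hγ0 hγ hε hε' hB hB' ha₀ ha₁) rfl
      (τ9_M_pos_theta13OfThm1CCMW F N j γ ε₀ ε₂₉ B₃ B₃' a₀ a₁) h15 h15G (hnum_theta13OfThm1CCMW hγ hB hB' ha₀ ha₁) εreg_le_theta13OfThm1CCMW
      hcomp hcompRev (hBα_theta13OfThm1CCMW hγ hB hB' ha₀.le ha₁.le)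
      (htI_theta13OfThm1CCMW hγ hB hB' ha₀.le ha₁.le) (htMS_theta13OfThm1CCMW hγ hB hB' ha₀.le ha₁.le) (hC1_theta13OfThm1CCMW hγ) ⟨j, theta13OfThm1CCMW_τ9_M F N j γ ε₀ ε₂₉ B₃ B₃' a₀ a₁⟩
      (fun p' n' s' hn1 hn' hw' hpc' => ⟨?_, ?_, ?_, hpc'⟩) p (n + 1) hn hw hpc s hsep (M₁_pos_theta13OfThm1CCMW F N j γ ε₀ ε₂₉ B₃ B₃' a₀ a₁) W h7
    · rw [theta13OfThm1CCMW_M₁]; exact hc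
    · have h := succ_add_le_of_partCompat₁₃ (theta13OfThm1CCMW F N j γ ε₀ ε₂₉ B₃ B₃' a₀ a₁) (theta13OfThm1CCMW_τ9_M F N j γ ε₀ ε₂₉ B₃ B₃' a₀ a₁) hn1 hpc'
        ((hC1_theta13OfThm1CCMW hγ) p' n' hn' hw')
      omega
    · rw [theta13OfThm1CCMW_τ9_M]; exact pow_dvd_pow F.L hc₁


end AtWitnessGridGuard

/-! ## §3  Closers under the CANDIDATE guard, (hcomp) ∧ (hcompRev), on EVERY family — p635083 §3 with the guard replaced -/

section ClosersGridGuard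

variable {j c c₀ c₁ : ℕ} {γ ε₀ ε₂₉ B₃ B₃' a₀ a₁ : ℝ}

/-- **THE K0 BODY (⁵) FOR `F` AT `N = 2` AT `θ₁₅ᶜᶜᴹᵂ(j; γ)` UNDER THE CANDIDATE GUARD** (16a's socket ∘ the row above) — p635083 §3's first closer with the guard replaced.
CONDITIONAL; K0 NOT closed here. [cite: Balaban1985Variational, Thm 1 (8)–(9) p.279, Prop. 8 p.304; Balaban1988Convergent, Thm 1 p.262, (2.1) p.254, (2.4)–(2.8) pp.255–256, p.257; Balaban1987RG1, Thm 1 p.259, (0.1) p.251] -/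
theorem exists_k0SepCoP_thm1CCMW_gridGuard_of_thm1RegSepCoP7MG_of_thm1GaugeG_of_hcomp_allTorus (F : T4Family) (hγ0 : 0 < γ) (hγ : γ ≤ 1 / 2) (hε : 0 < ε₀) (hε' : 0 < ε₂₉) (hB : 0 ≤ B₃)
    (hB' : 0 ≤ B₃') (ha₀ : 0 < a₀) (ha₁ : 0 < a₁) (hc : c ≤ F.L ^ j) (hc₀ : c₀ ≤ j + 1) (hc₁ : c₁ ≤ j)
    (h15 : VariationalThm1RegSepCoP7MG F 2 (fun ν M g K k _s => c ≤ ν.M₁ ∧ k + c₀ ≤ F.m + K ∧ F.L ^ c₁ ∣ M ∧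
      ∀ i, 1 ≤ i → i ≤ k → dCubeSide (F.P K).L M (RkOfRecord (F.P K).L ν.r (g i)) i ∣ (F.P K).sitesPerDir 0) B₃ a₀ a₁)
    (h15G : VariationalThm1GaugeRegSepCoP7MG F 2 (F.L ^ j) (fun ν M g K k _s => c ≤ ν.M₁ ∧ k + c₀ ≤ F.m + K ∧ F.L ^ c₁ ∣ M ∧
      ∀ i, 1 ≤ i → i ≤ k → dCubeSide (F.P K).L M (RkOfRecord (F.P K).L ν.r (g i)) i ∣ (F.P K).sitesPerDir 0) B₃ B₃' a₀ a₁)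
    (hcomp : ∀ (p : B12.RunParams) (n : ℕ), n ≤ p.K → Step.InInterval (theta13OfThm1CCMW F 2 j γ ε₀ ε₂₉ B₃ B₃' a₀ a₁).γ n (gOfRecord₁₃ F 2 (theta13OfThm1CCMW F 2 j γ ε₀ ε₂₉ B₃ B₃' a₀ a₁) p) → ∀ m, m < n →
      (theta13OfThm1CCMW F 2 j γ ε₀ ε₂₉ B₃ B₃' a₀ a₁).s2.cR * epsOfRecord (theta13OfThm1CCMW F 2 j γ ε₀ ε₂₉ B₃ B₃' a₀ a₁).ν (gOfRecord₁₃ F 2 (theta13OfThm1CCMW F 2 j γ ε₀ ε₂₉ B₃ B₃' a₀ a₁) p) m ≤ 2 * ((theta13OfThm1CCMW F 2 j γ ε₀ ε₂₉ B₃ B₃' a₀ a₁).s2.cR * epsOfRecord (theta13OfThm1CCMW F 2 j γ ε₀ ε₂₉ B₃ B₃' a₀ a₁).ν (gOfRecord₁₃ F 2 (theta13OfThm1CCMW F 2 j γ ε₀ ε₂₉ B₃ B₃' a₀ a₁) p) (m + 1)))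
    (hcompRev : ∀ (p : B12.RunParams) (n : ℕ), n ≤ p.K → Step.InInterval (theta13OfThm1CCMW F 2 j γ ε₀ ε₂₉ B₃ B₃' a₀ a₁).γ n (gOfRecord₁₃ F 2 (theta13OfThm1CCMW F 2 j γ ε₀ ε₂₉ B₃ B₃' a₀ a₁) p) → ∀ m, m < n →
      (theta13OfThm1CCMW F 2 j γ ε₀ ε₂₉ B₃ B₃' a₀ a₁).s2.cR * epsOfRecord (theta13OfThm1CCMW F 2 j γ ε₀ ε₂₉ B₃ B₃' a₀ a₁).ν (gOfRecord₁₃ F 2 (theta13OfThm1CCMW F 2 j γ ε₀ ε₂₉ B₃ B₃' a₀ a₁) p) (m + 1) ≤ 2 * ((theta13OfThm1CCMW F 2 j γ ε₀ ε₂₉ B₃ B₃' a₀ a₁).s2.cR * epsOfRecord (theta13OfThm1CCMW F 2 j γ ε₀ ε₂₉ B₃ B₃' a₀ a₁).ν (gOfRecord₁₃ F 2 (theta13OfThm1CCMW F 2 j γ ε₀ ε₂₉ B₃ B₃' a₀ a₁) p) m)) :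
    ∃ θ : Stage13Params F 2, θ.Provisos₁₃SepCoP F 2 ∧ (θ.ZtUnity F 2 ∧ θ.SlotsNondegenerate₁₃ F 2) ∧ θ.Admissible F 2 :=
  exists_k0SepCoP_of_bgSepCoP_theta13LiveOfNumerics F (stage12NumericsOfThm1CCMW_pos_of_le_half (L := F.L) (j := j) F.hL.2.le hγ0 hγ hε hB hB' ha₀ ha₁) hε' ⟨j, rfl⟩ (dvd_refl _)
    (bgSepCoPAt_theta13OfThm1CCMW_gridGuard_of_thm1RegSepCoP7MG_of_thm1GaugeG_of_hcomp_allTorus hγ0 hγ hε hε' hB hB' ha₀ ha₁ hc hc₀ hc₁ h15 h15G hcomp hcompRev)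

/-- **THE ⁷ IMAGE, ON EVERY FAMILY, UNDER THE CANDIDATE GUARD** (FILE 18's cured lift, T's history-blind door) — p635083 §3's second closer with the guard replaced.  CONDITIONAL.
[cite: Balaban1985Variational, Thm 1 (8) p.279, Prop. 8 p.304; Balaban1988Convergent, Thm 1 p.262, (2.1) p.254, (2.21) p.258; Balaban1989LargeFieldI, (0.2)–(0.4) p.176] -/
theorem exists_k0SepCoPH_thm1CCMW_gridGuard_of_thm1RegSepCoP7MG_of_thm1GaugeG_of_hcomp_allTorus (F : T4Family) (hγ0 : 0 < γ) (hγ : γ ≤ 1 / 2) (hε : 0 < ε₀) (hε' : 0 < ε₂₉) (hB : 0 ≤ B₃)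
    (hB' : 0 ≤ B₃') (ha₀ : 0 < a₀) (ha₁ : 0 < a₁) (hc : c ≤ F.L ^ j) (hc₀ : c₀ ≤ j + 1) (hc₁ : c₁ ≤ j)
    (h15 : VariationalThm1RegSepCoP7MG F 2 (fun ν M g K k _s => c ≤ ν.M₁ ∧ k + c₀ ≤ F.m + K ∧ F.L ^ c₁ ∣ M ∧
      ∀ i, 1 ≤ i → i ≤ k → dCubeSide (F.P K).L M (RkOfRecord (F.P K).L ν.r (g i)) i ∣ (F.P K).sitesPerDir 0) B₃ a₀ a₁)
    (h15G : VariationalThm1GaugeRegSepCoP7MG F 2 (F.L ^ j) (fun ν M g K k _s => c ≤ ν.M₁ ∧ k + c₀ ≤ F.m + K ∧ F.L ^ c₁ ∣ M ∧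
      ∀ i, 1 ≤ i → i ≤ k → dCubeSide (F.P K).L M (RkOfRecord (F.P K).L ν.r (g i)) i ∣ (F.P K).sitesPerDir 0) B₃ B₃' a₀ a₁)
    (hcomp : ∀ (p : B12.RunParams) (n : ℕ), n ≤ p.K → Step.InInterval (theta13OfThm1CCMW F 2 j γ ε₀ ε₂₉ B₃ B₃' a₀ a₁).γ n (gOfRecord₁₃ F 2 (theta13OfThm1CCMW F 2 j γ ε₀ ε₂₉ B₃ B₃' a₀ a₁) p) → ∀ m, m < n →
      (theta13OfThm1CCMW F 2 j γ ε₀ ε₂₉ B₃ B₃' a₀ a₁).s2.cR * epsOfRecord (theta13OfThm1CCMW F 2 j γ ε₀ ε₂₉ B₃ B₃' a₀ a₁).ν (gOfRecord₁₃ F 2 (theta13OfThm1CCMW F 2 j γ ε₀ ε₂₉ B₃ B₃' a₀ a₁) p) m ≤ 2 * ((theta13OfThm1CCMW F 2 j γ ε₀ ε₂₉ B₃ B₃' a₀ a₁).s2.cR * epsOfRecord (theta13OfThm1CCMW F 2 j γ ε₀ ε₂₉ B₃ B₃' a₀ a₁).ν (gOfRecord₁₃ F 2 (theta13OfThm1CCMW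 F 2 j γ ε₀ ε₂₉ B₃ B₃' a₀ a₁) p) (m + 1)))
    (hcompRev : ∀ (p : B12.RunParams) (n : ℕ), n ≤ p.K → Step.InInterval (theta13OfThm1CCMW F 2 j γ ε₀ ε₂₉ B₃ B₃' a₀ a₁).γ n (gOfRecord₁₃ F 2 (theta13OfThm1CCMW F 2 j γ ε₀ ε₂₉ B₃ B₃' a₀ a₁) p) → ∀ m, m < n →
      (theta13OfThm1CCMW F 2 j γ ε₀ ε₂₉ B₃ B₃' a₀ a₁).s2.cR * epsOfRecord (theta13OfThm1CCMW F 2 j γ ε₀ ε₂₉ B₃ B₃' a₀ a₁).ν (gOfRecord₁₃ F 2 (theta13OfThm1CCMW F 2 j γ ε₀ ε₂₉ B₃ B₃' a₀ a₁) p) (m + 1) ≤ 2 * ((theta13OfThm1CCMW F 2 j γ ε₀ ε₂₉ B₃ B₃' a₀ a₁).s2.cR * epsOfRecord (theta13OfThm1CCMW F 2 j γ ε₀ ε₂₉ B₃ B₃' a₀ a₁).ν (gOfRecord₁₃ F 2 (theta13OfThm1CCMW F 2 j γ ε₀ ε₂₉ B₃ B₃' a₀ a₁) p) m)) :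
    ∃ θ : Stage13HParams F 2, θ.Provisos₁₃SepCoPH F 2 ∧ (θ.ZhUnity F 2 ∧ θ.SlotsNondegenerate₁₃ F 2) ∧ θ.Admissible F 2 :=
  exists_k0SepCoPH_of_exists_k0SepCoPR (exists_k0SepCoPR_of_exists_k0SepCoP F
    (exists_k0SepCoP_thm1CCMW_gridGuard_of_thm1RegSepCoP7MG_of_thm1GaugeG_of_hcomp_allTorus F hγ0 hγ hε hε' hB hB' ha₀ ha₁ hc hc₀ hc₁ h15 h15G hcomp hcompRev))

/-- **★★ THE ⁷ K0 BODY KEYED ON THE GUARDED (8) AND THE GUARDED (9)-STEP FACT AT `(L^j, Adm)` UNDER THE CANDIDATE GUARD, ON EVERY FAMILY** (dag-n07-e module 51's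
`variationalThm1GaugeRegSepCoP7MG_of_gauge9TopStepG`, guard-generic) — p635083 §3's third closer with the guard replaced: the K0 body CLOSES under the four-conjunct
candidate exactly as under V20-G.  CONDITIONAL; the candidate is NOT a registered text.
[cite: Balaban1985Variational, Thm 1 (8)–(9) p.279, (144)–(152) pp.300–301, Prop. 8 p.304; Balaban1988Convergent, Thm 1 p.262, (2.1) p.254, (2.21) p.258, p.257; Balaban1989LargeFieldI, (0.2)–(0.4) p.176] -/
theorem exists_k0SepCoPH_thm1CCMW_gridGuard_of_thm1RegSepCoP7MG_of_gauge9TopStepG_of_hcomp_allTorus (F : T4Family) (hγ0 : 0 < γ) (hγ : γ ≤ 1 / 2) (hε : 0 < ε₀) (hε' : 0 < ε₂₉)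
    (hB : 0 ≤ B₃) (hB' : 0 ≤ B₃') (ha₀ : 0 < a₀) (ha₁ : 0 < a₁) (hc : c ≤ F.L ^ j) (hc₀ : c₀ ≤ j + 1) (hc₁ : c₁ ≤ j)
    (h15 : VariationalThm1RegSepCoP7MG F 2 (fun ν M g K k _s => c ≤ ν.M₁ ∧ k + c₀ ≤ F.m + K ∧ F.L ^ c₁ ∣ M ∧
      ∀ i, 1 ≤ i → i ≤ k → dCubeSide (F.P K).L M (RkOfRecord (F.P K).L ν.r (g i)) i ∣ (F.P K).sitesPerDir 0) B₃ a₀ a₁)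
    (h9 : Gauge9RegSepTopStepG F 2 (fun ν K Ω => suppDomOfRecord F ν K Ω) (F.L ^ j) (fun ν M g K k _s => c ≤ ν.M₁ ∧ k + c₀ ≤ F.m + K ∧ F.L ^ c₁ ∣ M ∧
      ∀ i, 1 ≤ i → i ≤ k → dCubeSide (F.P K).L M (RkOfRecord (F.P K).L ν.r (g i)) i ∣ (F.P K).sitesPerDir 0) B₃ B₃' a₀ a₁)
    (hcomp : ∀ (p : B12.RunParams) (n : ℕ), n ≤ p.K → Step.InInterval (theta13OfThm1CCMW F 2 j γ ε₀ ε₂₉ B₃ B₃' a₀ a₁).γ n (gOfRecord₁₃ F 2 (theta13OfThm1CCMW F 2 j γ ε₀ ε₂₉ B₃ B₃' a₀ a₁) p) → ∀ m, m < n →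
      (theta13OfThm1CCMW F 2 j γ ε₀ ε₂₉ B₃ B₃' a₀ a₁).s2.cR * epsOfRecord (theta13OfThm1CCMW F 2 j γ ε₀ ε₂₉ B₃ B₃' a₀ a₁).ν (gOfRecord₁₃ F 2 (theta13OfThm1CCMW F 2 j γ ε₀ ε₂₉ B₃ B₃' a₀ a₁) p) m ≤ 2 * ((theta13OfThm1CCMW F 2 j γ ε₀ ε₂₉ B₃ B₃' a₀ a₁).s2.cR * epsOfRecord (theta13OfThm1CCMW F 2 j γ ε₀ ε₂₉ B₃ B₃' a₀ a₁).ν (gOfRecord₁₃ F 2 (theta13OfThm1CCMW F 2 j γ ε₀ ε₂₉ B₃ B₃' a₀ a₁) p) (m + 1)))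
    (hcompRev : ∀ (p : B12.RunParams) (n : ℕ), n ≤ p.K → Step.InInterval (theta13OfThm1CCMW F 2 j γ ε₀ ε₂₉ B₃ B₃' a₀ a₁).γ n (gOfRecord₁₃ F 2 (theta13OfThm1CCMW F 2 j γ ε₀ ε₂₉ B₃ B₃' a₀ a₁) p) → ∀ m, m < n →
      (theta13OfThm1CCMW F 2 j γ ε₀ ε₂₉ B₃ B₃' a₀ a₁).s2.cR * epsOfRecord (theta13OfThm1CCMW F 2 j γ ε₀ ε₂₉ B₃ B₃' a₀ a₁).ν (gOfRecord₁₃ F 2 (theta13OfThm1CCMW F 2 j γ ε₀ ε₂₉ B₃ B₃' a₀ a₁) p) (m + 1) ≤ 2 * ((theta13OfThm1CCMW F 2 j γ ε₀ ε₂₉ B₃ B₃' a₀ a₁).s2.cR * epsOfRecord (theta13OfThm1CCMW F 2 j γ ε₀ ε₂₉ B₃ B₃' a₀ a₁).ν (gOfRecord₁₃ F 2 (theta13OfThm1CCMW F 2 j γ ε₀ ε₂₉ B₃ B₃' a₀ a₁) p) m)) :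
    ∃ θ : Stage13HParams F 2, θ.Provisos₁₃SepCoPH F 2 ∧ (θ.ZhUnity F 2 ∧ θ.SlotsNondegenerate₁₃ F 2) ∧ θ.Admissible F 2 :=
  exists_k0SepCoPH_thm1CCMW_gridGuard_of_thm1RegSepCoP7MG_of_thm1GaugeG_of_hcomp_allTorus F hγ0 hγ hε hε' hB hB' ha₀ ha₁ hc hc₀ hc₁ h15
    (variationalThm1GaugeRegSepCoP7MG_of_gauge9TopStepG h9) hcomp hcompRev


/-- **★★ THE ⁷ K0 BODY FROM THE (8)-STEP SENTENCE UNDER THE CANDIDATE GUARD** — what a V21-G stub 1 would display (`Prop8RegSepTopStepG F 2 suppDom Adm B₃ a₀ a₁` at the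
four-conjunct `Adm`), through dag-n07-e module 53's guard-generic bridge `variationalThm1RegSepCoP7MG_of_prop8TopStepG` and the closer above.  CONDITIONAL on the two sentences;
NOT a registered text; K0⁷ OPEN. [cite: Balaban1985Variational, Thm 1 (8)–(9) p.279, Prop. 8 p.304, p.304 lines 1–2; Balaban1988Convergent, Thm 1 p.262, (2.1) p.254, p.257; Balaban1987RG1, (0.1) p.251] -/
theorem exists_k0SepCoPH_thm1CCMW_gridGuard_of_prop8TopStepG_of_gauge9TopStepG_of_hcomp_allTorus (F : T4Family) (hγ0 : 0 < γ) (hγ : γ ≤ 1 / 2) (hε : 0 < ε₀) (hε' : 0 < ε₂₉)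
    (hB : 0 < B₃) (hB' : 0 ≤ B₃') (ha₀ : 0 < a₀) (ha₁ : 0 < a₁) (hc : c ≤ F.L ^ j) (hc₀ : c₀ ≤ j + 1) (hc₁ : c₁ ≤ j)
    (h8 : Prop8RegSepTopStepG F 2 (fun ν K Ω => suppDomOfRecord F ν K Ω) (fun ν M g K k _s => c ≤ ν.M₁ ∧ k + c₀ ≤ F.m + K ∧ F.L ^ c₁ ∣ M ∧
      ∀ i, 1 ≤ i → i ≤ k → dCubeSide (F.P K).L M (RkOfRecord (F.P K).L ν.r (g i)) i ∣ (F.P K).sitesPerDir 0) B₃ a₀ a₁)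
    (h9 : Gauge9RegSepTopStepG F 2 (fun ν K Ω => suppDomOfRecord F ν K Ω) (F.L ^ j) (fun ν M g K k _s => c ≤ ν.M₁ ∧ k + c₀ ≤ F.m + K ∧ F.L ^ c₁ ∣ M ∧
      ∀ i, 1 ≤ i → i ≤ k → dCubeSide (F.P K).L M (RkOfRecord (F.P K).L ν.r (g i)) i ∣ (F.P K).sitesPerDir 0) B₃ B₃' a₀ a₁)
    (hcomp : ∀ (p : B12.RunParams) (n : ℕ), n ≤ p.K → Step.InInterval (theta13OfThm1CCMW F 2 j γ ε₀ ε₂₉ B₃ B₃' a₀ a₁).γ n (gOfRecord₁₃ F 2 (theta13OfThm1CCMW F 2 j γ ε₀ ε₂₉ B₃ B₃' a₀ a₁) p) → ∀ m, m < n →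
      (theta13OfThm1CCMW F 2 j γ ε₀ ε₂₉ B₃ B₃' a₀ a₁).s2.cR * epsOfRecord (theta13OfThm1CCMW F 2 j γ ε₀ ε₂₉ B₃ B₃' a₀ a₁).ν (gOfRecord₁₃ F 2 (theta13OfThm1CCMW F 2 j γ ε₀ ε₂₉ B₃ B₃' a₀ a₁) p) m ≤ 2 * ((theta13OfThm1CCMW F 2 j γ ε₀ ε₂₉ B₃ B₃' a₀ a₁).s2.cR * epsOfRecord (theta13OfThm1CCMW F 2 j γ ε₀ ε₂₉ B₃ B₃' a₀ a₁).ν (gOfRecord₁₃ F 2 (theta13OfThm1CCMW F 2 j γ ε₀ ε₂₉ B₃ B₃' a₀ a₁) p) (m + 1)))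
    (hcompRev : ∀ (p : B12.RunParams) (n : ℕ), n ≤ p.K → Step.InInterval (theta13OfThm1CCMW F 2 j γ ε₀ ε₂₉ B₃ B₃' a₀ a₁).γ n (gOfRecord₁₃ F 2 (theta13OfThm1CCMW F 2 j γ ε₀ ε₂₉ B₃ B₃' a₀ a₁) p) → ∀ m, m < n →
      (theta13OfThm1CCMW F 2 j γ ε₀ ε₂₉ B₃ B₃' a₀ a₁).s2.cR * epsOfRecord (theta13OfThm1CCMW F 2 j γ ε₀ ε₂₉ B₃ B₃' a₀ a₁).ν (gOfRecord₁₃ F 2 (theta13OfThm1CCMW F 2 j γ ε₀ ε₂₉ B₃ B₃' a₀ a₁) p) (m + 1) ≤ 2 * ((theta13OfThm1CCMW F 2 j γ ε₀ ε₂₉ B₃ B₃' a₀ a₁).s2.cR * epsOfRecord (theta13OfThm1CCMW F 2 j γ ε₀ ε₂₉ B₃ B₃' a₀ a₁).ν (gOfRecord₁₃ F 2 (theta13OfThm1CCMW F 2 j γ ε₀ ε₂₉ B₃ B₃' a₀ a₁) p) m)) :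
    ∃ θ : Stage13HParams F 2, θ.Provisos₁₃SepCoPH F 2 ∧ (θ.ZhUnity F 2 ∧ θ.SlotsNondegenerate₁₃ F 2) ∧ θ.Admissible F 2 :=
  exists_k0SepCoPH_thm1CCMW_gridGuard_of_thm1RegSepCoP7MG_of_gauge9TopStepG_of_hcomp_allTorus F hγ0 hγ hε hε' hB.le hB' ha₀ ha₁ hc hc₀ hc₁
    (variationalThm1RegSepCoP7MG_of_prop8TopStepG hB h8) h9 hcomp hcompRev

end ClosersGridGuard

end Summit.QuantumFields.YangMills.Theorems.K0Stub1GridNumericsGuardWitness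

end
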